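import Summits.ResolutionOfSingularities.ResolutionOfSingularities.Theorems.FrobeniusLadderFInjectiveMacaulayficationDerivativeCertificate
import HarnessLib

/-!
# BED TCa (`z⁴ + x²y² + x⁵ + y⁵ + u⁵ + t⁵`, char 2, tangent cone `(z²+xy)²`): FLOOR 1 IS FULL — the F-side, all five charts, by DERIVATIVE CERTIFICATES
# (crux `FInjectiveMacaulayfication` stmt-ResolutionOfSingularities-15315, chain w45a; res-L1-w45a-plan-1 RULINGS R21.17 (3)(a) / R21.18 (1) «TCa FLOOR-1-FULL row: stub-1/stub-3 file
# it from idea-1's sorry-free sketch r27»; seat res-L1-w45a-stub-1 g12 = PORT (def-free, chart polynomials spelled out) of res-L1-w45a-idea-1 g26's `Sketch-L1-idea-1-r27.lean`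
# 10dd1e9ef7fd95be §C/§C′/§D/§D′/§D″ — the mathematics and the certificates are idea-1's; the (O) obstruction stubs §B are NOT here (owner stub-3, R21.17 (3)(d)))

[OURS · L1 W4.5a] Support file (`--supports stmt-ResolutionOfSingularities-15315 --as helper`); def-free; UNCONDITIONAL; no named fact; NOT a statement of any manuscript.
HONEST LABEL (R21.17 (3)(a)): a «FLOOR-1-FULL row» — the point floor of TCa is legal and ALREADY FULL, so the F-half instance holds with the floor itself; species-3
(intrinsically Tjurina-degenerate) bed, recurrence depth 0. AI-written (AI review weaker than expert review).

`X 0 = x, X 1 = y, X 2 = u, X 3 = t, X 4 = z`; `f = z⁴ + x²y² + x⁵ + y⁵ + u⁵ + t⁵`; point blow-up chart `i` (`X j ↦ X j · X i`, divide by `X i ^ 4`).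
* §C the five strict transforms `g₀ … g₄` (spelled out), `aeval_chart0_fTCa` / `aeval_chart4_fTCa`, their partials, and the DERIVATIVE CERTIFICATES `tca_cert_0 … tca_cert_4`
  (explicit `k[X]`-combinations of iterated partials equal to `1`);
* §D (idea-1's O4/O5) `pderiv_mem_span_of_consts`, `pow_not_mem_frobeniusPower_of_derivative_certificate`, `pow_not_mem_span_pow_of_derivative_certificate`,
  ★ `clause_at_maximal_of_derivative_certificate` (certificate + `g ≠ 0` ⇒ the crux's per-stalk clause at EVERY maximal ideal of `k[X]/(g)`, via
  `FedderAtMaximalIdeal.stub_fedderAtMaximalIdeal`; complements ✓ p660352's single-word form);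
* §D″ `hcert_tcaChart0 … 4`, `tcaChart_ne_zero`, ★★ `tca_clause_every_chart_every_point` = the `hpts` input of `GermOfGlobalBlowup.hypersurfacePointBlowup_fullCl` for all five
  charts of `Bl_0(TCa)`. The row itself (`hypersurfacePointBlowup_fullCl` + res-L1-w45a-stub-3's `…TCaSpecimen`/`…TCaPointFloor`: prime, `hθ`, `hoff`) is one application away.
[cite: Fedder1983, Prop. 1.7 and Thm. 1.12]
-/

-- single-problem summit: the doubled namespace component is forced
set_option linter.dupNamespace false

noncomputable section

open MvPolynomial

namespace Summit.ResolutionOfSingularities.ResolutionOfSingularities.Theorems.FInjectiveMacaulayfication.TCaFloorOneFull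

open Summit.ResolutionOfSingularities.ResolutionOfSingularities.Theorems.FInjectiveMacaulayfication

/-! ## §C Floor 1 of TCa: the five strict transforms and their DERIVATIVE CERTIFICATES `1 ∈ (∂^ε f′)`

Point blow-up chart `i` (`X j ↦ X j · X i` for `j ≠ i`, divide by `X i ^ 4`), chart coordinates renamed `X 0 … X 4` (`X i` = the exceptional coordinate). -/


/-- The strict transforms ARE the chart transforms of `fTCa`: chart `x`. [OURS · computation] -/
theorem aeval_chart0_fTCa (k : Type) [Field k] :
    aeval (fun j : Fin 5 => if j = 0 then (X 0 : MvPolynomial (Fin 5) k) else X j * X 0) (((X 4 ^ 4 + X 0 ^ 2 * X 1 ^ 2 + X 0 ^ 5 + X 1 ^ 5 + X 2 ^ 5 + X 3 ^ 5 : MvPolynomial (Fin 5) k))) = X 0 ^ 4 * ((X 4 ^ 4 + X 1 ^ 2 + X 0 * (1 + X 1 ^ 5 + X 2 ^ 5 + X 3 ^ 5) : MvPolynomial (Fin 5) k)) := by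
  simp only [map_add, map_pow, map_mul, aeval_X, Fin.isValue]
  simp (config := {decide := true}) only [if_true, if_false, Fin.isValue]
  ring

/-- chart `z`. [OURS · computation] -/
theorem aeval_chart4_fTCa (k : Type) [Field k] :
    aeval (fun j : Fin 5 => if j = 4 then (X 4 : MvPolynomial (Fin 5) k) else X j * X 4) (((X 4 ^ 4 + X 0 ^ 2 * X 1 ^ 2 + X 0 ^ 5 + X 1 ^ 5 + X 2 ^ 5 + X 3 ^ 5 : MvPolynomial (Fin 5) k))) = X 4 ^ 4 * ((1 + X 0 ^ 2 * X 1 ^ 2 + X 4 * (X 0 ^ 5 + X 1 ^ 5 + X 2 ^ 5 + X 3 ^ 5) : MvPolynomial (Fin 5) k)) := by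
  simp only [map_add, map_pow, map_mul, aeval_X, Fin.isValue]
  simp (config := {decide := true}) only [if_true, if_false, Fin.isValue]
  ring

/-- `2 = 0`, `5 = 1` in `k[X]`, characteristic 2. [folklore] -/
theorem two_five (k : Type) [Field k] [CharP k 2] : (2 : MvPolynomial (Fin 5) k) = 0 ∧ (5 : MvPolynomial (Fin 5) k) = 1 := by
  have h2 : (2 : MvPolynomial (Fin 5) k) = 0 := by
    have : ((2 : ℕ) : MvPolynomial (Fin 5) k) = 0 := CharP.cast_eq_zero _ 2
    simpa using this
  refine ⟨h2, ?_⟩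
  calc (5 : MvPolynomial (Fin 5) k) = 2 * 2 + 1 := by norm_num
    _ = 1 := by rw [h2]; ring

/-- `∂₀ f′` on chart `x`: `1 + y₁⁵ + u₁⁵ + t₁⁵` (no characteristic needed). [OURS · computation] -/
theorem pderiv0_tcaChart0 (k : Type) [Field k] : pderiv 0 (((X 4 ^ 4 + X 1 ^ 2 + X 0 * (1 + X 1 ^ 5 + X 2 ^ 5 + X 3 ^ 5) : MvPolynomial (Fin 5) k))) = 1 + X 1 ^ 5 + X 2 ^ 5 + X 3 ^ 5 := by
  simp (disch := decide) only [map_add, pderiv_mul, pderiv_pow, pderiv_one, pderiv_X_self, pderiv_X_of_ne,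
    mul_zero, one_mul, add_zero, zero_add]

/-- `∂_j f′ = x · y_j⁴` on chart `x` for `j = 1, 2, 3` (characteristic 2: `2 = 0`, `5 = 1`). [OURS · computation] -/
theorem pderivj_tcaChart0 (k : Type) [Field k] [CharP k 2] (j : Fin 5) (hj : j = 1 ∨ j = 2 ∨ j = 3) :
    pderiv j (((X 4 ^ 4 + X 1 ^ 2 + X 0 * (1 + X 1 ^ 5 + X 2 ^ 5 + X 3 ^ 5) : MvPolynomial (Fin 5) k))) = X 0 * X j ^ 4 := by
  obtain ⟨h2, h5⟩ := two_five k
  rcases hj with rfl | rfl | rfl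
  all_goals
    simp (disch := decide) only [map_add, pderiv_mul, pderiv_pow, pderiv_one, pderiv_X_self, pderiv_X_of_ne,
      mul_zero, zero_mul, mul_one, add_zero, zero_add]
    push_cast
  · linear_combination X 1 * h2 + X 0 * X 1 ^ 4 * h5
  · linear_combination X 0 * X 2 ^ 4 * h5
  · linear_combination X 0 * X 3 ^ 4 * h5

/-- `∂₀∂_j f′ = y_j⁴` on chart `x` for `j = 1, 2, 3`. [OURS · computation] -/
theorem pderiv0j_tcaChart0 (k : Type) [Field k] [CharP k 2] (j : Fin 5) (hj : j = 1 ∨ j = 2 ∨ j = 3) :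
    pderiv 0 (pderiv j (((X 4 ^ 4 + X 1 ^ 2 + X 0 * (1 + X 1 ^ 5 + X 2 ^ 5 + X 3 ^ 5) : MvPolynomial (Fin 5) k)))) = X j ^ 4 := by
  rw [pderivj_tcaChart0 k j hj]
  have hj0 : j ≠ 0 := by rcases hj with rfl | rfl | rfl <;> decide
  simp (disch := decide) only [pderiv_mul, pderiv_pow, pderiv_X_self, pderiv_X_of_ne hj0, mul_zero, one_mul, add_zero]

/-- **DERIVATIVE CERTIFICATE, chart `x`:** `∂₀f′ + y₁·∂₀∂₁f′ + u₁·∂₀∂₂f′ + t₁·∂₀∂₃f′ = 1`. Hence `f′ ∉ Q^[2]` at every prime `Q` (§D): the `x`-chart of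
`Bl_0(TCa)` is F-pure — FULL — at every point, although singular along the surface `V(x, z₁² + y₁, 1 + y₁⁵ + u₁⁵ + t₁⁵)`. The charts `y`, `u`, `t` are the same
identity with the roles of the variables exchanged (`tcaChart1/2/3`). [OURS · computation] -/
theorem tca_cert_0 (k : Type) [Field k] [CharP k 2] :
    pderiv 0 (((X 4 ^ 4 + X 1 ^ 2 + X 0 * (1 + X 1 ^ 5 + X 2 ^ 5 + X 3 ^ 5) : MvPolynomial (Fin 5) k))) + X 1 * pderiv 0 (pderiv 1 (((X 4 ^ 4 + X 1 ^ 2 + X 0 * (1 + X 1 ^ 5 + X 2 ^ 5 + X 3 ^ 5) : MvPolynomial (Fin 5) k)))) + X 2 * pderiv 0 (pderiv 2 (((X 4 ^ 4 + X 1 ^ 2 + X 0 * (1 + X 1 ^ 5 + X 2 ^ 5 + X 3 ^ 5) : MvPolynomial (Fin 5) k))))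
      + X 3 * pderiv 0 (pderiv 3 (((X 4 ^ 4 + X 1 ^ 2 + X 0 * (1 + X 1 ^ 5 + X 2 ^ 5 + X 3 ^ 5) : MvPolynomial (Fin 5) k)))) = 1 := by
  obtain ⟨h2, -⟩ := two_five k
  rw [pderiv0_tcaChart0, pderiv0j_tcaChart0 k 1 (Or.inl rfl), pderiv0j_tcaChart0 k 2 (Or.inr (Or.inl rfl)),
    pderiv0j_tcaChart0 k 3 (Or.inr (Or.inr rfl))]
  linear_combination (X 1 ^ 5 + X 2 ^ 5 + X 3 ^ 5) * h2

/-- `∂₄ f′ = x₁⁵ + y₁⁵ + u₁⁵ + t₁⁵` on chart `z`. [OURS · computation] -/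
theorem pderiv4_tcaChart4 (k : Type) [Field k] : pderiv 4 (((1 + X 0 ^ 2 * X 1 ^ 2 + X 4 * (X 0 ^ 5 + X 1 ^ 5 + X 2 ^ 5 + X 3 ^ 5) : MvPolynomial (Fin 5) k))) = X 0 ^ 5 + X 1 ^ 5 + X 2 ^ 5 + X 3 ^ 5 := by
  simp (disch := decide) only [map_add, pderiv_mul, pderiv_pow, pderiv_one, pderiv_X_self, pderiv_X_of_ne,
    mul_zero, zero_mul, one_mul, add_zero, zero_add]

/-- `∂₀ f′ = z · x₁⁴` on chart `z` (characteristic 2). [OURS · computation] -/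
theorem pderiv0_tcaChart4 (k : Type) [Field k] [CharP k 2] : pderiv 0 (((1 + X 0 ^ 2 * X 1 ^ 2 + X 4 * (X 0 ^ 5 + X 1 ^ 5 + X 2 ^ 5 + X 3 ^ 5) : MvPolynomial (Fin 5) k))) = X 4 * X 0 ^ 4 := by
  obtain ⟨h2, h5⟩ := two_five k
  simp (disch := decide) only [map_add, pderiv_mul, pderiv_pow, pderiv_one, pderiv_X_self, pderiv_X_of_ne,
    mul_zero, zero_mul, mul_one, add_zero, zero_add]
  push_cast
  linear_combination X 0 * X 1 ^ 2 * h2 + X 4 * X 0 ^ 4 * h5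

/-- `∂₄∂₀ f′ = x₁⁴` on chart `z`. [OURS · computation] -/
theorem pderiv40_tcaChart4 (k : Type) [Field k] [CharP k 2] : pderiv 4 (pderiv 0 (((1 + X 0 ^ 2 * X 1 ^ 2 + X 4 * (X 0 ^ 5 + X 1 ^ 5 + X 2 ^ 5 + X 3 ^ 5) : MvPolynomial (Fin 5) k)))) = X 0 ^ 4 := by
  rw [pderiv0_tcaChart4]
  simp (disch := decide) only [pderiv_mul, pderiv_pow, pderiv_X_self, pderiv_X_of_ne, mul_zero, one_mul, add_zero]

/-- **DERIVATIVE CERTIFICATE, chart `z`:** `(f′ + z·∂₄f′)² + y₁⁴ · ∂₄∂₀f′ = 1` (`f′ + z∂₄f′ = 1 + x₁²y₁²` and its square is `1 + x₁⁴y₁⁴` in characteristic 2;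
`∂₄∂₀f′ = x₁⁴`). [OURS · computation] -/
theorem tca_cert_4 (k : Type) [Field k] [CharP k 2] :
    (((1 + X 0 ^ 2 * X 1 ^ 2 + X 4 * (X 0 ^ 5 + X 1 ^ 5 + X 2 ^ 5 + X 3 ^ 5) : MvPolynomial (Fin 5) k)) + X 4 * pderiv 4 (((1 + X 0 ^ 2 * X 1 ^ 2 + X 4 * (X 0 ^ 5 + X 1 ^ 5 + X 2 ^ 5 + X 3 ^ 5) : MvPolynomial (Fin 5) k)))) ^ 2 + X 1 ^ 4 * pderiv 4 (pderiv 0 (((1 + X 0 ^ 2 * X 1 ^ 2 + X 4 * (X 0 ^ 5 + X 1 ^ 5 + X 2 ^ 5 + X 3 ^ 5) : MvPolynomial (Fin 5) k)))) = 1 := by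
  obtain ⟨h2, -⟩ := two_five k
  rw [pderiv4_tcaChart4, pderiv40_tcaChart4]
  linear_combination ((X 0 ^ 2 * X 1 ^ 2) ^ 2 + X 0 ^ 2 * X 1 ^ 2 + 2 * (X 4 * (X 0 ^ 5 + X 1 ^ 5 + X 2 ^ 5 + X 3 ^ 5))
    + 2 * (X 0 ^ 2 * X 1 ^ 2) * (X 4 * (X 0 ^ 5 + X 1 ^ 5 + X 2 ^ 5 + X 3 ^ 5)) + 2 * (X 4 * (X 0 ^ 5 + X 1 ^ 5 + X 2 ^ 5 + X 3 ^ 5)) ^ 2) * h2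

/-! ## §C′ The remaining charts `y`, `u`, `t` of `Bl_0(TCa)` (same identity with the variables exchanged) -/

/-- `∂₁ f′` on chart `y`. [OURS · computation] -/
theorem pderiv1_tcaChart1 (k : Type) [Field k] : pderiv 1 (((X 4 ^ 4 + X 0 ^ 2 + X 1 * (1 + X 0 ^ 5 + X 2 ^ 5 + X 3 ^ 5) : MvPolynomial (Fin 5) k))) = 1 + X 0 ^ 5 + X 2 ^ 5 + X 3 ^ 5 := by
  simp (disch := decide) only [map_add, pderiv_mul, pderiv_pow, pderiv_one, pderiv_X_self, pderiv_X_of_ne,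
    mul_zero, one_mul, add_zero, zero_add]

/-- `∂₂ f′` on chart `u`. [OURS · computation] -/
theorem pderiv2_tcaChart2 (k : Type) [Field k] : pderiv 2 (((X 4 ^ 4 + X 0 ^ 2 * X 1 ^ 2 + X 2 * (1 + X 0 ^ 5 + X 1 ^ 5 + X 3 ^ 5) : MvPolynomial (Fin 5) k))) = 1 + X 0 ^ 5 + X 1 ^ 5 + X 3 ^ 5 := by
  simp (disch := decide) only [map_add, pderiv_mul, pderiv_pow, pderiv_one, pderiv_X_self, pderiv_X_of_ne,
    mul_zero, zero_mul, one_mul, add_zero, zero_add]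

/-- `∂₃ f′` on chart `t`. [OURS · computation] -/
theorem pderiv3_tcaChart3 (k : Type) [Field k] : pderiv 3 (((X 4 ^ 4 + X 0 ^ 2 * X 1 ^ 2 + X 3 * (1 + X 0 ^ 5 + X 1 ^ 5 + X 2 ^ 5) : MvPolynomial (Fin 5) k))) = 1 + X 0 ^ 5 + X 1 ^ 5 + X 2 ^ 5 := by
  simp (disch := decide) only [map_add, pderiv_mul, pderiv_pow, pderiv_one, pderiv_X_self, pderiv_X_of_ne,
    mul_zero, zero_mul, one_mul, add_zero, zero_add]

/-- `∂_j (1 + X_a⁵ + X_b⁵ + X_c⁵) = X_j⁴` for `j ∈ {a,b,c}` pairwise distinct (characteristic 2: `5 = 1`). [OURS · computation] -/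
theorem pderiv_quintic (k : Type) [Field k] [CharP k 2] (a b c j : Fin 5) (hab : a ≠ b) (hac : a ≠ c) (hbc : b ≠ c)
    (hj : j = a ∨ j = b ∨ j = c) :
    pderiv j (1 + X a ^ 5 + X b ^ 5 + X c ^ 5 : MvPolynomial (Fin 5) k) = X j ^ 4 := by
  obtain ⟨h2, h5⟩ := two_five k
  rcases hj with rfl | rfl | rfl
  · simp only [map_add, pderiv_one, pderiv_pow, pderiv_X_self, pderiv_X_of_ne (Ne.symm hab), pderiv_X_of_ne (Ne.symm hac),
      mul_zero, mul_one, add_zero, zero_add]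
    push_cast
    linear_combination X j ^ 4 * h5
  · simp only [map_add, pderiv_one, pderiv_pow, pderiv_X_self, pderiv_X_of_ne hab, pderiv_X_of_ne (Ne.symm hbc),
      mul_zero, mul_one, add_zero, zero_add]
    push_cast
    linear_combination X j ^ 4 * h5
  · simp only [map_add, pderiv_one, pderiv_pow, pderiv_X_self, pderiv_X_of_ne hac, pderiv_X_of_ne hbc,
      mul_zero, mul_one, add_zero, zero_add]
    push_cast
    linear_combination X j ^ 4 * h5

/-- **DERIVATIVE CERTIFICATE, chart `y`:** `∂₁f′ + x₁·∂₀∂₁f′ + u₁·∂₂∂₁f′ + t₁·∂₃∂₁f′ = 1`. [OURS · computation] -/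
theorem tca_cert_1 (k : Type) [Field k] [CharP k 2] :
    pderiv 1 (((X 4 ^ 4 + X 0 ^ 2 + X 1 * (1 + X 0 ^ 5 + X 2 ^ 5 + X 3 ^ 5) : MvPolynomial (Fin 5) k))) + X 0 * pderiv 0 (pderiv 1 (((X 4 ^ 4 + X 0 ^ 2 + X 1 * (1 + X 0 ^ 5 + X 2 ^ 5 + X 3 ^ 5) : MvPolynomial (Fin 5) k)))) + X 2 * pderiv 2 (pderiv 1 (((X 4 ^ 4 + X 0 ^ 2 + X 1 * (1 + X 0 ^ 5 + X 2 ^ 5 + X 3 ^ 5) : MvPolynomial (Fin 5) k))))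
      + X 3 * pderiv 3 (pderiv 1 (((X 4 ^ 4 + X 0 ^ 2 + X 1 * (1 + X 0 ^ 5 + X 2 ^ 5 + X 3 ^ 5) : MvPolynomial (Fin 5) k)))) = 1 := by
  obtain ⟨h2, -⟩ := two_five k
  rw [pderiv1_tcaChart1, pderiv_quintic k 0 2 3 0 (by decide) (by decide) (by decide) (Or.inl rfl),
    pderiv_quintic k 0 2 3 2 (by decide) (by decide) (by decide) (Or.inr (Or.inl rfl)),
    pderiv_quintic k 0 2 3 3 (by decide) (by decide) (by decide) (Or.inr (Or.inr rfl))]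
  linear_combination (X 0 ^ 5 + X 2 ^ 5 + X 3 ^ 5) * h2

/-- **DERIVATIVE CERTIFICATE, chart `u`:** `∂₂f′ + x₁·∂₀∂₂f′ + y₁·∂₁∂₂f′ + t₁·∂₃∂₂f′ = 1`. [OURS · computation] -/
theorem tca_cert_2 (k : Type) [Field k] [CharP k 2] :
    pderiv 2 (((X 4 ^ 4 + X 0 ^ 2 * X 1 ^ 2 + X 2 * (1 + X 0 ^ 5 + X 1 ^ 5 + X 3 ^ 5) : MvPolynomial (Fin 5) k))) + X 0 * pderiv 0 (pderiv 2 (((X 4 ^ 4 + X 0 ^ 2 * X 1 ^ 2 + X 2 * (1 + X 0 ^ 5 + X 1 ^ 5 + X 3 ^ 5) : MvPolynomial (Fin 5) k)))) + X 1 * pderiv 1 (pderiv 2 (((X 4 ^ 4 + X 0 ^ 2 * X 1 ^ 2 + X 2 * (1 + X 0 ^ 5 + X 1 ^ 5 + X 3 ^ 5) : MvPolynomial (Fin 5) k))))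
      + X 3 * pderiv 3 (pderiv 2 (((X 4 ^ 4 + X 0 ^ 2 * X 1 ^ 2 + X 2 * (1 + X 0 ^ 5 + X 1 ^ 5 + X 3 ^ 5) : MvPolynomial (Fin 5) k)))) = 1 := by
  obtain ⟨h2, -⟩ := two_five k
  rw [pderiv2_tcaChart2, pderiv_quintic k 0 1 3 0 (by decide) (by decide) (by decide) (Or.inl rfl),
    pderiv_quintic k 0 1 3 1 (by decide) (by decide) (by decide) (Or.inr (Or.inl rfl)),
    pderiv_quintic k 0 1 3 3 (by decide) (by decide) (by decide) (Or.inr (Or.inr rfl))]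
  linear_combination (X 0 ^ 5 + X 1 ^ 5 + X 3 ^ 5) * h2

/-- **DERIVATIVE CERTIFICATE, chart `t`:** `∂₃f′ + x₁·∂₀∂₃f′ + y₁·∂₁∂₃f′ + u₁·∂₂∂₃f′ = 1`. [OURS · computation] -/
theorem tca_cert_3 (k : Type) [Field k] [CharP k 2] :
    pderiv 3 (((X 4 ^ 4 + X 0 ^ 2 * X 1 ^ 2 + X 3 * (1 + X 0 ^ 5 + X 1 ^ 5 + X 2 ^ 5) : MvPolynomial (Fin 5) k))) + X 0 * pderiv 0 (pderiv 3 (((X 4 ^ 4 + X 0 ^ 2 * X 1 ^ 2 + X 3 * (1 + X 0 ^ 5 + X 1 ^ 5 + X 2 ^ 5) : MvPolynomial (Fin 5) k)))) + X 1 * pderiv 1 (pderiv 3 (((X 4 ^ 4 + X 0 ^ 2 * X 1 ^ 2 + X 3 * (1 + X 0 ^ 5 + X 1 ^ 5 + X 2 ^ 5) : MvPolynomial (Fin 5) k))))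
      + X 2 * pderiv 2 (pderiv 3 (((X 4 ^ 4 + X 0 ^ 2 * X 1 ^ 2 + X 3 * (1 + X 0 ^ 5 + X 1 ^ 5 + X 2 ^ 5) : MvPolynomial (Fin 5) k)))) = 1 := by
  obtain ⟨h2, -⟩ := two_five k
  rw [pderiv3_tcaChart3, pderiv_quintic k 0 1 2 0 (by decide) (by decide) (by decide) (Or.inl rfl),
    pderiv_quintic k 0 1 2 1 (by decide) (by decide) (by decide) (Or.inr (Or.inl rfl)),
    pderiv_quintic k 0 1 2 2 (by decide) (by decide) (by decide) (Or.inr (Or.inr rfl))]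
  linear_combination (X 0 ^ 5 + X 1 ^ 5 + X 2 ^ 5) * h2

/-! ## §D The generic lemma behind §C — PROVED (was offered stub O4): derivations preserve ideals generated by `∂`-constants (e.g. `p`-th powers),
so a derivative certificate `1 ∈ (iterated partials of g^(p-1))` forbids `g^(p-1) ∈ Q^[p]` for every proper `Q`, and `g^(p-1) ∈ (a₁^p, …, a_m^p)` for every proper `(a)`. -/

/-- The `k[X]`-ideal generated by a set of `∂`-CONSTANTS (all partials zero — e.g. `p`-th powers in characteristic `p`) is stable under every `∂/∂X_i`
(Leibniz). [OURS · elementary] -/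
theorem pderiv_mem_span_of_consts {σ R : Type*} [CommRing R] (G : Set (MvPolynomial σ R))
    (hG : ∀ g ∈ G, ∀ i : σ, pderiv i g = 0) (i : σ) {h : MvPolynomial σ R} (hh : h ∈ Ideal.span G) :
    pderiv i h ∈ Ideal.span G := by
  induction hh using Submodule.span_induction with
  | mem x hx => rw [hG x hx i]; exact Submodule.zero_mem _
  | zero => rw [map_zero]; exact Submodule.zero_mem _
  | add x y _ _ hx hy => rw [map_add]; exact Submodule.add_mem _ hx hy
  | smul a x hx' hx =>
      rw [smul_eq_mul, pderiv_mul]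
      exact Submodule.add_mem _ (Ideal.mul_mem_left _ _ hx') (Ideal.mul_mem_left _ _ hx)

/-- **O4 — PROVED. A DERIVATIVE CERTIFICATE FORBIDS `g^(p-1) ∈ Q^[p]` for every proper ideal `Q`.** If `1` lies in the ideal spanned by every set `T ∋ g^(p-1)`
closed under the partial derivatives, then `g^(p-1) ∉ Q^[p]`: `Q^[p] = (q^p : q ∈ Q)` is `∂`-stable (`pderiv_mem_span_of_consts`), so it would contain `1`, whence
`Q ⊇ Q^p ⊇ Q^[p] ∋ 1`. [OURS · elementary] -/
theorem pow_not_mem_frobeniusPower_of_derivative_certificate (p : ℕ) [Fact p.Prime] (k : Type) [Field k] [CharP k p] {n : ℕ}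
    (g : MvPolynomial (Fin n) k)
    (hcert : ∀ T : Set (MvPolynomial (Fin n) k), g ^ (p - 1) ∈ T → (∀ s ∈ T, ∀ i : Fin n, pderiv i s ∈ T) → (1 : MvPolynomial (Fin n) k) ∈ Ideal.span T)
    (Q : Ideal (MvPolynomial (Fin n) k)) (hQ : Q ≠ ⊤) :
    g ^ (p - 1) ∉ Literature.RingTheory.TightClosure.frobeniusPower p Q := by
  intro hmem
  have hG : ∀ q ∈ ((fun x : MvPolynomial (Fin n) k => x ^ p) '' (Q : Set (MvPolynomial (Fin n) k))), ∀ i : Fin n, pderiv i q = 0 := by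
    rintro _ ⟨x, -, rfl⟩ i
    exact DerivativeCertificate.pderiv_pow_p_eq_zero p i x
  have h1 := hcert (Literature.RingTheory.TightClosure.frobeniusPower p Q : Set (MvPolynomial (Fin n) k)) hmem
    (fun s hs i => by
      rw [SetLike.mem_coe, Literature.RingTheory.TightClosure.frobeniusPower_def] at hs ⊢
      exact pderiv_mem_span_of_consts _ hG i hs)
  rw [Ideal.span_eq] at h1
  exact hQ ((Ideal.eq_top_iff_one _).mpr
    (Ideal.pow_le_self (Nat.Prime.ne_zero Fact.out) (Literature.RingTheory.TightClosure.frobeniusPower_le_pow p Q h1)))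

/-- **O5′ — PROVED, the form `stub_fedderAtMaximalIdeal` consumes.** With a derivative certificate, `g^(p-1) ∉ (a₁^p, …, a_m^p)` for every family `a` generating a
PROPER ideal (the ideal `(aᵢ^p)` is `∂`-stable; it would contain `1`; but `(aᵢ^p) ⊆ (a) ≠ k[X]`). [OURS · elementary] -/
theorem pow_not_mem_span_pow_of_derivative_certificate (p : ℕ) [Fact p.Prime] (k : Type) [Field k] [CharP k p] {n m : ℕ}
    (g : MvPolynomial (Fin n) k)
    (hcert : ∀ T : Set (MvPolynomial (Fin n) k), g ^ (p - 1) ∈ T → (∀ s ∈ T, ∀ i : Fin n, pderiv i s ∈ T) → (1 : MvPolynomial (Fin n) k) ∈ Ideal.span T)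
    (a : Fin m → MvPolynomial (Fin n) k) (ha : Ideal.span (Set.range a) ≠ ⊤) :
    g ^ (p - 1) ∉ Ideal.span (Set.range fun i : Fin m => a i ^ p) := by
  intro hmem
  have hG : ∀ q ∈ Set.range (fun i : Fin m => a i ^ p), ∀ j : Fin n, pderiv j q = 0 := by
    rintro _ ⟨i, rfl⟩ j
    exact DerivativeCertificate.pderiv_pow_p_eq_zero p j (a i)
  have h1 := hcert (Ideal.span (Set.range fun i : Fin m => a i ^ p) : Set (MvPolynomial (Fin n) k)) hmem
    (fun s hs j => by
      rw [SetLike.mem_coe] at hs ⊢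
      exact pderiv_mem_span_of_consts _ hG j hs)
  rw [Ideal.span_eq] at h1
  apply ha
  rw [Ideal.eq_top_iff_one]
  refine (Ideal.span_le.mpr ?_) h1
  rintro _ ⟨i, rfl⟩
  exact Ideal.pow_mem_of_mem _ (Ideal.subset_span (Set.mem_range_self i)) _ (Nat.Prime.pos Fact.out)

/-! ## §D′ The `hpts`-READY COROLLARY (was offered stub O5): a derivative certificate for `g` gives the crux's per-stalk clause of `k[X]/(g)` at EVERY closed point —
one application of the tree's `FedderAtMaximalIdeal.stub_fedderAtMaximalIdeal` (Fedder 1983 Prop. 1.7 / Thm. 1.12 route, any residue field) to Nullstellensatz-free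
generators obtained from Noetherianity. This is exactly the input `hpts` of `GermOfGlobalBlowup.hypersurfacePointBlowup_fullCl`, chart by chart. -/

/-- **CLAUSE AT EVERY CLOSED POINT FROM A DERIVATIVE CERTIFICATE.** [OURS · assembly of `stub_fedderAtMaximalIdeal` + O5′] -/
theorem clause_at_maximal_of_derivative_certificate (p : ℕ) [Fact p.Prime] (k : Type) [Field k] [CharP k p] {n : ℕ}
    (g : MvPolynomial (Fin n) k) (hg0 : g ≠ 0)
    (hcert : ∀ T : Set (MvPolynomial (Fin n) k), g ^ (p - 1) ∈ T → (∀ s ∈ T, ∀ i : Fin n, pderiv i s ∈ T) → (1 : MvPolynomial (Fin n) k) ∈ Ideal.span T)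
    (Q : Ideal (MvPolynomial (Fin n) k ⧸ Ideal.span {g})) [Q.IsMaximal] :
    ∀ d : ℕ, ringKrullDim (Localization.AtPrime Q) = d → ∀ s : Fin d → Localization.AtPrime Q,
      (Ideal.span (Set.range s)).radical.IsMaximal →
        RingTheory.Sequence.IsWeaklyRegular (Localization.AtPrime Q) (List.ofFn s) ∧
        ∀ y : Localization.AtPrime Q, (∃ e : ℕ, y ^ p ^ e ∈ Ideal.span
          ((fun z : Localization.AtPrime Q => z ^ p ^ e) ''
            (Ideal.span (Set.range s) : Set (Localization.AtPrime Q)))) → y ∈ Ideal.span (Set.range s) := by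
  -- generators of the contracted maximal ideal `P = Q ∩ k[X]` (Noetherian)
  obtain ⟨m, a, ha⟩ := Submodule.fg_iff_exists_fin_generating_family.mp
    (IsNoetherian.noetherian (Q.comap (Ideal.Quotient.mk (Ideal.span {g}))))
  have hP : Q.comap (Ideal.Quotient.mk (Ideal.span {g})) = Ideal.span (Set.range a) := ha.symm
  have hne : Ideal.span (Set.range a) ≠ ⊤ := by
    rw [← hP]
    exact Ideal.comap_ne_top _ (Ideal.IsMaximal.ne_top inferInstance)
  exact FedderAtMaximalIdeal.stub_fedderAtMaximalIdeal p k n m a g Q hP hg0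
    (pow_not_mem_span_pow_of_derivative_certificate p k g hcert a hne)

/-! ## §D″ TCa, all five charts: the certificates of §C/§C′ in `hcert` form, and the per-chart clause at every closed point (the F-side of a TCa row with `K = ⊤`). -/

/-- From an explicit identity to the `hcert` form (characteristic 2: `g^(2-1) = g`). Chart `x`. [OURS] -/
theorem hcert_tcaChart0 (k : Type) [Field k] [CharP k 2] :
    ∀ T : Set (MvPolynomial (Fin 5) k), ((X 4 ^ 4 + X 1 ^ 2 + X 0 * (1 + X 1 ^ 5 + X 2 ^ 5 + X 3 ^ 5) : MvPolynomial (Fin 5) k)) ^ (2 - 1) ∈ T → (∀ s ∈ T, ∀ i : Fin 5, pderiv i s ∈ T) →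
      (1 : MvPolynomial (Fin 5) k) ∈ Ideal.span T := by
  intro T hg hT
  rw [show (2 - 1 : ℕ) = 1 from rfl, pow_one] at hg
  rw [← tca_cert_0 k]
  have d0 := hT _ hg 0
  have d01 := hT _ (hT _ hg 1) 0
  have d02 := hT _ (hT _ hg 2) 0
  have d03 := hT _ (hT _ hg 3) 0
  exact Submodule.add_mem _ (Submodule.add_mem _ (Submodule.add_mem _ (Ideal.subset_span d0)
    (Ideal.mul_mem_left _ _ (Ideal.subset_span d01))) (Ideal.mul_mem_left _ _ (Ideal.subset_span d02)))
    (Ideal.mul_mem_left _ _ (Ideal.subset_span d03))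

/-- Chart `y`. [OURS] -/
theorem hcert_tcaChart1 (k : Type) [Field k] [CharP k 2] :
    ∀ T : Set (MvPolynomial (Fin 5) k), ((X 4 ^ 4 + X 0 ^ 2 + X 1 * (1 + X 0 ^ 5 + X 2 ^ 5 + X 3 ^ 5) : MvPolynomial (Fin 5) k)) ^ (2 - 1) ∈ T → (∀ s ∈ T, ∀ i : Fin 5, pderiv i s ∈ T) →
      (1 : MvPolynomial (Fin 5) k) ∈ Ideal.span T := by
  intro T hg hT
  rw [show (2 - 1 : ℕ) = 1 from rfl, pow_one] at hg
  rw [← tca_cert_1 k]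
  have d1 := hT _ hg 1
  have d10 := hT _ d1 0
  have d12 := hT _ d1 2
  have d13 := hT _ d1 3
  exact Submodule.add_mem _ (Submodule.add_mem _ (Submodule.add_mem _ (Ideal.subset_span d1)
    (Ideal.mul_mem_left _ _ (Ideal.subset_span d10))) (Ideal.mul_mem_left _ _ (Ideal.subset_span d12)))
    (Ideal.mul_mem_left _ _ (Ideal.subset_span d13))

/-- Chart `u`. [OURS] -/
theorem hcert_tcaChart2 (k : Type) [Field k] [CharP k 2] :
    ∀ T : Set (MvPolynomial (Fin 5) k), ((X 4 ^ 4 + X 0 ^ 2 * X 1 ^ 2 + X 2 * (1 + X 0 ^ 5 + X 1 ^ 5 + X 3 ^ 5) : MvPolynomial (Fin 5) k)) ^ (2 - 1) ∈ T → (∀ s ∈ T, ∀ i : Fin 5, pderiv i s ∈ T) →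
      (1 : MvPolynomial (Fin 5) k) ∈ Ideal.span T := by
  intro T hg hT
  rw [show (2 - 1 : ℕ) = 1 from rfl, pow_one] at hg
  rw [← tca_cert_2 k]
  have d2 := hT _ hg 2
  have d20 := hT _ d2 0
  have d21 := hT _ d2 1
  have d23 := hT _ d2 3
  exact Submodule.add_mem _ (Submodule.add_mem _ (Submodule.add_mem _ (Ideal.subset_span d2)
    (Ideal.mul_mem_left _ _ (Ideal.subset_span d20))) (Ideal.mul_mem_left _ _ (Ideal.subset_span d21)))
    (Ideal.mul_mem_left _ _ (Ideal.subset_span d23))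

/-- Chart `t`. [OURS] -/
theorem hcert_tcaChart3 (k : Type) [Field k] [CharP k 2] :
    ∀ T : Set (MvPolynomial (Fin 5) k), ((X 4 ^ 4 + X 0 ^ 2 * X 1 ^ 2 + X 3 * (1 + X 0 ^ 5 + X 1 ^ 5 + X 2 ^ 5) : MvPolynomial (Fin 5) k)) ^ (2 - 1) ∈ T → (∀ s ∈ T, ∀ i : Fin 5, pderiv i s ∈ T) →
      (1 : MvPolynomial (Fin 5) k) ∈ Ideal.span T := by
  intro T hg hT
  rw [show (2 - 1 : ℕ) = 1 from rfl, pow_one] at hg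
  rw [← tca_cert_3 k]
  have d3 := hT _ hg 3
  have d30 := hT _ d3 0
  have d31 := hT _ d3 1
  have d32 := hT _ d3 2
  exact Submodule.add_mem _ (Submodule.add_mem _ (Submodule.add_mem _ (Ideal.subset_span d3)
    (Ideal.mul_mem_left _ _ (Ideal.subset_span d30))) (Ideal.mul_mem_left _ _ (Ideal.subset_span d31)))
    (Ideal.mul_mem_left _ _ (Ideal.subset_span d32))

/-- Chart `z`: `(f′ + z ∂₄f′)² + y₁⁴ ∂₄∂₀ f′ = 1`. [OURS] -/
theorem hcert_tcaChart4 (k : Type) [Field k] [CharP k 2] :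
    ∀ T : Set (MvPolynomial (Fin 5) k), ((1 + X 0 ^ 2 * X 1 ^ 2 + X 4 * (X 0 ^ 5 + X 1 ^ 5 + X 2 ^ 5 + X 3 ^ 5) : MvPolynomial (Fin 5) k)) ^ (2 - 1) ∈ T → (∀ s ∈ T, ∀ i : Fin 5, pderiv i s ∈ T) →
      (1 : MvPolynomial (Fin 5) k) ∈ Ideal.span T := by
  intro T hg hT
  rw [show (2 - 1 : ℕ) = 1 from rfl, pow_one] at hg
  rw [← tca_cert_4 k]
  have d4 := hT _ hg 4
  have d04 := hT _ (hT _ hg 0) 4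
  have hlin : ((1 + X 0 ^ 2 * X 1 ^ 2 + X 4 * (X 0 ^ 5 + X 1 ^ 5 + X 2 ^ 5 + X 3 ^ 5) : MvPolynomial (Fin 5) k)) + X 4 * pderiv 4 (((1 + X 0 ^ 2 * X 1 ^ 2 + X 4 * (X 0 ^ 5 + X 1 ^ 5 + X 2 ^ 5 + X 3 ^ 5) : MvPolynomial (Fin 5) k))) ∈ Ideal.span T :=
    Submodule.add_mem _ (Ideal.subset_span hg) (Ideal.mul_mem_left _ _ (Ideal.subset_span d4))
  rw [pow_two]
  exact Submodule.add_mem _ (Ideal.mul_mem_left _ _ hlin) (Ideal.mul_mem_left _ _ (Ideal.subset_span d04))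

/-- The chart polynomials are nonzero (value `1` at a rational point). [OURS · computation] -/
theorem tcaChart_ne_zero (k : Type) [Field k] :
    ((X 4 ^ 4 + X 1 ^ 2 + X 0 * (1 + X 1 ^ 5 + X 2 ^ 5 + X 3 ^ 5) : MvPolynomial (Fin 5) k)) ≠ 0 ∧ ((X 4 ^ 4 + X 0 ^ 2 + X 1 * (1 + X 0 ^ 5 + X 2 ^ 5 + X 3 ^ 5) : MvPolynomial (Fin 5) k)) ≠ 0 ∧ ((X 4 ^ 4 + X 0 ^ 2 * X 1 ^ 2 + X 2 * (1 + X 0 ^ 5 + X 1 ^ 5 + X 3 ^ 5) : MvPolynomial (Fin 5) k)) ≠ 0 ∧ ((X 4 ^ 4 + X 0 ^ 2 * X 1 ^ 2 + X 3 * (1 + X 0 ^ 5 + X 1 ^ 5 + X 2 ^ 5) : MvPolynomial (Fin 5) k)) ≠ 0 ∧ ((1 + X 0 ^ 2 * X 1 ^ 2 + X 4 * (X 0 ^ 5 + X 1 ^ 5 + X 2 ^ 5 + X 3 ^ 5) : MvPolynomial (Fin 5) k)) ≠ 0 := by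
  refine ⟨?_, ?_, ?_, ?_, ?_⟩
  · intro h
    have := congrArg (MvPolynomial.eval (fun j : Fin 5 => if j = 0 then (1 : k) else 0)) h
    simp at this
  · intro h
    have := congrArg (MvPolynomial.eval (fun j : Fin 5 => if j = 1 then (1 : k) else 0)) h
    simp at this
  · intro h
    have := congrArg (MvPolynomial.eval (fun j : Fin 5 => if j = 2 then (1 : k) else 0)) h
    simp at this
  · intro h
    have := congrArg (MvPolynomial.eval (fun j : Fin 5 => if j = 3 then (1 : k) else 0)) h
    simp at this
  · intro h
    have := congrArg (MvPolynomial.eval (fun _ : Fin 5 => (0 : k))) h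
    simp at this

/-- **THE F-SIDE OF THE TCa ROW, ALL FIVE CHARTS: at every closed point of every chart of `Bl_0 {z⁴+x²y²+x⁵+y⁵+u⁵+t⁵ = 0}` (characteristic 2) the local ring
satisfies the crux's per-stalk clause** (every s.o.p. weakly regular ∧ generates a Frobenius-closed ideal) — although `Bl_0` is SINGULAR along a surface. This is the
`hpts` input of `GermOfGlobalBlowup.hypersurfacePointBlowup_fullCl` for `f = fTCa`, `μ = 4`, `g = tcaChart`. [OURS] -/
theorem tca_clause_every_chart_every_point (k : Type) [Field k] [CharP k 2] :
    ∀ g ∈ [((X 4 ^ 4 + X 1 ^ 2 + X 0 * (1 + X 1 ^ 5 + X 2 ^ 5 + X 3 ^ 5) : MvPolynomial (Fin 5) k)), ((X 4 ^ 4 + X 0 ^ 2 + X 1 * (1 + X 0 ^ 5 + X 2 ^ 5 + X 3 ^ 5) : MvPolynomial (Fin 5) k)), ((X 4 ^ 4 + X 0 ^ 2 * X 1 ^ 2 + X 2 * (1 + X 0 ^ 5 + X 1 ^ 5 + X 3 ^ 5) : MvPolynomial (Fin 5) k)), ((X 4 ^ 4 + X 0 ^ 2 * X 1 ^ 2 +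 X 3 * (1 + X 0 ^ 5 + X 1 ^ 5 + X 2 ^ 5) : MvPolynomial (Fin 5) k)), ((1 + X 0 ^ 2 * X 1 ^ 2 + X 4 * (X 0 ^ 5 + X 1 ^ 5 + X 2 ^ 5 + X 3 ^ 5) : MvPolynomial (Fin 5) k))],
    ∀ (Q : Ideal (MvPolynomial (Fin 5) k ⧸ Ideal.span {g})) [Q.IsMaximal],
    ∀ d : ℕ, ringKrullDim (Localization.AtPrime Q) = d → ∀ s : Fin d → Localization.AtPrime Q,
      (Ideal.span (Set.range s)).radical.IsMaximal →
        RingTheory.Sequence.IsWeaklyRegular (Localization.AtPrime Q) (List.ofFn s) ∧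
        ∀ y : Localization.AtPrime Q, (∃ e : ℕ, y ^ 2 ^ e ∈ Ideal.span
          ((fun z : Localization.AtPrime Q => z ^ 2 ^ e) ''
            (Ideal.span (Set.range s) : Set (Localization.AtPrime Q)))) → y ∈ Ideal.span (Set.range s) := by
  haveI : Fact (Nat.Prime 2) := ⟨Nat.prime_two⟩
  obtain ⟨h0, h1, h2, h3, h4⟩ := tcaChart_ne_zero k
  intro g hg Q _
  simp only [List.mem_cons, List.mem_nil_iff, or_false] at hg
  rcases hg with rfl | rfl | rfl | rfl | rfl
  · exact clause_at_maximal_of_derivative_certificate 2 k _ h0 (hcert_tcaChart0 k) Q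
  · exact clause_at_maximal_of_derivative_certificate 2 k _ h1 (hcert_tcaChart1 k) Q
  · exact clause_at_maximal_of_derivative_certificate 2 k _ h2 (hcert_tcaChart2 k) Q
  · exact clause_at_maximal_of_derivative_certificate 2 k _ h3 (hcert_tcaChart3 k) Q
  · exact clause_at_maximal_of_derivative_certificate 2 k _ h4 (hcert_tcaChart4 k) Q

end Summit.ResolutionOfSingularities.ResolutionOfSingularities.Theorems.FInjectiveMacaulayfication.TCaFloorOneFull

end
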